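import Summits.RiemannHypothesis.RiemannHypothesis.Theorems.GroundBartaPolarPerronFrobeniusSignImprovingBarrierEvenSharp
import HarnessLib

/-!
# PF persistence — leaf G1.19 (Markov / Beurling–Deny criteria): the SIGN-IMPROVING WINDOW predicate, and
# its emptiness for `ζ` at every window `a ≥ 3/10` (even sector: `a ≥ 33/100`) (pub-rhpf, barrier-typer gen 3)

**HONEST FRAMING. This is a long-odds MECHANISM SEARCH; no RH claims.** CASE-DAG leaf G1.19 / RULING A10 (a) ask for the ONE-LINE
binding of the cell's "Beurling–Deny / positivity-improving criterion" to the tree's certified barrier (prover B,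
`GroundBartaPolarPerronFrobeniusSignImprovingBarrier*.lean`): the windowed Weil form of `ζ` at window `a` is SIGN-IMPROVING if passing
from a real window test `f` (supported in `[-a, a]`, with `|f|` again a test) to `|f|` never RAISES the real part of the Weil quadratic
form. A one-signed-ground-state criterion of Beurling–Deny / Jentzsch type for the full form is available only at sign-improving windows.
The tree PROVES the form is NOT sign-improving at every `a ≥ 3/10` (all tests) and `a ≥ 33/100` (even tests) — so as an ALL-WINDOW
criterion the class is EMPTY for `ζ` itself (leaf G1.19: `V0 EMPTY: ζ fails`), independently of any control: these criteria are not
candidates, and nothing here is a statement about positivity.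

* `SignImprovingWindow a`, `EvenSignImprovingWindow a` (TYPED; continuum predicates on the Weil form, window `a`);
* `not_signImprovingWindow_of_ge (ha : 3/10 ≤ a)`, `not_evenSignImprovingWindow_of_ge (ha : 33/100 ≤ a)` (PROVED, one line each over
  `PolarPerronFrobenius.sw_not_signImproving_of_ge` / `swe_even_not_signImproving_of_ge`);
* `not_forall_signImprovingWindow`, `not_forall_evenSignImprovingWindow` (the ∀-window forms are FALSE for `ζ`).
-/

set_option linter.dupNamespace false  -- the mandated namespace repeats `RiemannHypothesis`

noncomputable section

open Set Literature.NumberTheory.LFunctions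

namespace Summit.RiemannHypothesis.RiemannHypothesis.Theorems.PfPersistence

/-- Window `a` is SIGN-IMPROVING for the Weil form: for every real window test `f` supported in `[-a, a]` whose modulus `|f|` is again
a test, `Re Q(|f|) ≤ Re Q(f)` (the Beurling–Deny / first-Beurling–Deny-criterion input "`|u|` does not raise the energy"). [folklore] -/
def SignImprovingWindow (a : ℝ) : Prop :=
  ∀ f : ℝ → ℝ, IsWeilTest (fun t => ((f t : ℝ) : ℂ)) → IsWeilTest (fun t => ((|f t| : ℝ) : ℂ)) →
    tsupport f ⊆ Icc (-a) a →
    (weilQuadratic fun t => ((|f t| : ℝ) : ℂ)).re ≤ (weilQuadratic fun t => ((f t : ℝ) : ℂ)).re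

/-- The EVEN-sector version: the same inequality asked only of EVEN real window tests. [folklore] -/
def EvenSignImprovingWindow (a : ℝ) : Prop :=
  ∀ f : ℝ → ℝ, IsWeilTest (fun t => ((f t : ℝ) : ℂ)) → IsWeilTest (fun t => ((|f t| : ℝ) : ℂ)) →
    tsupport f ⊆ Icc (-a) a → (∀ t, f (-t) = f t) →
    (weilQuadratic fun t => ((|f t| : ℝ) : ℂ)).re ≤ (weilQuadratic fun t => ((f t : ℝ) : ℂ)).re

/-- PROVED: sign-improving for all tests ⇒ sign-improving for even tests. [folklore] -/
theorem SignImprovingWindow.even {a : ℝ} (h : SignImprovingWindow a) : EvenSignImprovingWindow a :=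
  fun f hf habs hsupp _ => h f hf habs hsupp

/-- the support of a pointwise difference lies in the union of the (topological) supports; with both inside the closed
window `[-a, a]`, so is the difference's topological support. [folklore] -/
theorem tsupport_sub_subset_Icc {p q : ℝ → ℝ} {a : ℝ} (hp : tsupport p ⊆ Icc (-a) a) (hq : tsupport q ⊆ Icc (-a) a) :
    tsupport (fun t => p t - q t) ⊆ Icc (-a) a := by
  refine closure_minimal (fun t ht => ?_) isClosed_Icc
  rw [Function.mem_support] at ht
  by_cases hpt : p t = 0
  · have hqt : q t ≠ 0 := fun hq0 => ht (by rw [hpt, hq0, sub_zero])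
    exact hq (subset_tsupport _ (Function.mem_support.2 hqt))
  · exact hp (subset_tsupport _ (Function.mem_support.2 hpt))

/-- **PROVED (leaf G1.19 is EMPTY for `ζ` from `a = 3/10` on):** the Weil form is NOT sign-improving at any window `a ≥ 3/10` — the
tree's certified bump pair `p, q` (disjoint supports, `|p − q| = p + q`) has `Re Q(p − q) < Re Q(p + q) = Re Q(|p − q|)`. [folklore] -/
theorem not_signImprovingWindow_of_ge {a : ℝ} (ha : 3 / 10 ≤ a) : ¬ SignImprovingWindow a := by
  intro h
  obtain ⟨p, q, hp, hq, hsp, hsq, -, -, -, habs, -, -, hlt⟩ := PolarPerronFrobenius.sw_not_signImproving_of_ge ha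
  have hf : IsWeilTest (fun t => ((p t - q t : ℝ) : ℂ)) := by
    have := hp.add (hq.const_mul (-1))
    convert this using 1
    funext t; simp only [Pi.add_apply, Complex.ofReal_sub]; ring
  have hEq : (fun t => ((|p t - q t| : ℝ) : ℂ)) = fun t => ((p t + q t : ℝ) : ℂ) := funext fun t => by rw [habs t]
  have hfabs : IsWeilTest (fun t => ((|p t - q t| : ℝ) : ℂ)) := by
    rw [hEq]
    have := hp.add hq
    convert this using 1
    funext t; simp only [Pi.add_apply, Complex.ofReal_add]
  have hle := h (fun t => p t - q t) hf hfabs (tsupport_sub_subset_Icc hsp hsq)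
  rw [hEq] at hle
  exact absurd hlt (not_lt.2 hle)

/-- **PROVED (even sector, from `a = 33/100` on):** the Weil form is NOT sign-improving on EVEN tests at any window `a ≥ 33/100`. [folklore] -/
theorem not_evenSignImprovingWindow_of_ge {a : ℝ} (ha : 33 / 100 ≤ a) : ¬ EvenSignImprovingWindow a := by
  intro h
  obtain ⟨p, q, hp, hq, hsp, hsq, hpe, hqe, -, -, -, habs, -, -, hlt⟩ :=
    PolarPerronFrobenius.swe_even_not_signImproving_of_ge ha
  have hf : IsWeilTest (fun t => ((p t - q t : ℝ) : ℂ)) := by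
    have := hp.add (hq.const_mul (-1))
    convert this using 1
    funext t; simp only [Pi.add_apply, Complex.ofReal_sub]; ring
  have hEq : (fun t => ((|p t - q t| : ℝ) : ℂ)) = fun t => ((p t + q t : ℝ) : ℂ) := funext fun t => by rw [habs t]
  have hfabs : IsWeilTest (fun t => ((|p t - q t| : ℝ) : ℂ)) := by
    rw [hEq]
    have := hp.add hq
    convert this using 1
    funext t; simp only [Pi.add_apply, Complex.ofReal_add]
  have heven : ∀ t, p (-t) - q (-t) = p t - q t := fun t => by rw [hpe t, hqe t]
  have hle := h (fun t => p t - q t) hf hfabs (tsupport_sub_subset_Icc hsp hsq) heven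
  rw [hEq] at hle
  exact absurd hlt (not_lt.2 hle)

/-- PROVED: the ALL-WINDOW Beurling–Deny criterion is FALSE for `ζ` (leaf G1.19 `V0 EMPTY`). [folklore] -/
theorem not_forall_signImprovingWindow : ¬ ∀ a : ℝ, 0 < a → SignImprovingWindow a :=
  fun h => not_signImprovingWindow_of_ge (a := 3 / 10) le_rfl (h _ (by norm_num))

/-- PROVED: the all-window EVEN Beurling–Deny criterion is FALSE for `ζ`. [folklore] -/
theorem not_forall_evenSignImprovingWindow : ¬ ∀ a : ℝ, 0 < a → EvenSignImprovingWindow a :=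
  fun h => not_evenSignImprovingWindow_of_ge (a := 33 / 100) le_rfl (h _ (by norm_num))

/-- PROVED (cofinal form): NO window `a ≥ 3/10` is sign-improving — any criterion "sign-improving at all large windows" is empty
for `ζ` as well. [folklore] -/
theorem not_exists_signImprovingWindow_ge : ¬ ∃ a : ℝ, 3 / 10 ≤ a ∧ SignImprovingWindow a :=
  fun ⟨_, ha, h⟩ => not_signImprovingWindow_of_ge ha h

end Summit.RiemannHypothesis.RiemannHypothesis.Theorems.PfPersistence

end
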